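import Summits.Parity.GeneralizedHardyLittlewood.Theses.ZDegreeToeplitzBand
import Literature.NumberTheory.LFunctions.Zhang2022.KnifeEdgeLenZDegreePsiOn

/-!
# Route `ZDegreeToeplitzBand` — class-call support lemmas (half-class chain, weakness and satisfiability
# witnesses, the typed kill path of `ShortPairsSchurClose`)

D-0014 CLASS CALL (a+b) of 2026-08-27 (tenure planner ls-knife-plan g0; HOME/knife/CLASS-CALL.md v1.2, route
rev 3 193bb1b556da) split K1 `PsiGradedTables` into `ShortPairsCrossDegOne` / `ShortPairsDualDegOne` /
`LongPairsGradedTables` and K2 `PsiGradedTablesClose` into `ShortPairsTauTwoDark` / `ShortPairsSchurClose` (the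
C′ SIGN TEST, stmt-Parity-20430), C′ = `KnifeEdge.ShortPairs`. The two glue items are closed in
`Theorems/ZDegreeToeplitzBandPsiGradedTablesCloseOfShort.lean` (p529406) and
`Theorems/ZDegreeToeplitzBandPsiGradedTablesOfClasses.lean` (p530142). This file lands, verbatim from the planner's
classcall/Sketch.lean sha16 796308d61ff6dd96 (re-checked against the landed route file as
classcall/SketchProofs.lean sha16 59e4e9811261f6d6; linter binders fixed per ls-knife-crit-1 11:50:07Z), the
support lemmas that ride with the sign test stmt-Parity-20430:

* `theorem1_of_shortPairs` — K0 ∧ (short degree-1 tables) ∧ (dark) ∧ (Schur horn on short triples) ⇒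
  `Skeleton.Theorem1`: the half-class layer alone reaches the terminal, WITHOUT `LongPairsGradedTables` (𝒳₂)
  (via typer-1's `KnifeEdge.gradedClosesPsiOn_short_of_schur` / `theorem1_of_gradedClosesPsiOn_pack_eventually`,
  p521869's chain); the planner's `closes_via_children` (= the route's `closes h0 (psiGradedTablesOfClasses_proof
  hX' hY' hB) (psiGradedTablesCloseOfShort_proof hd hs)`, composition sanity) is NOT restated here: importing the
  two glue modules would put this file in their theses cone (`lint.theses-cone`);
* weakness witnesses `shortPairsCrossDegOne_of_parent`, `shortPairsDualDegOne_of_parent`,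
  `longPairsGradedTables_of_parent` (children are below their parents as typed) and the predicted-dark
  witnesses `shortPairsCrossDegOne_of_dark`, `shortPairsDualDegOne_of_dark` (`X₁ := 0`, `Y₁ := 0`);
* `shortPairsTauTwoDark_of_notAEventually`, `children_of_notAEventually` — SATISFIABILITY WITNESS for both
  split glues (director 11:12:04Z (4)): all five children hold simultaneously where (A) fails eventually, so
  neither glue has contradictory hypotheses;
* `shortPairsSchurClose_iff_notAEventually_of_dark` — the typed KILL PATH of the (a)-branch (typer-1 count v2
  10:59:03Z «short class PrintedTypeDark»): once BOTH degree-1 short cells are dark, `ShortPairsSchurClose` is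
  EQUIVALENT to «(A) fails eventually» (vacuous-true or summit-strength), using only `mainTermForm ≥ 0` on
  in-class pieces.

All (A)-guarded; the `_of_notAEventually` lemmas are conditional by design (witnesses, not closings). Pure
logic over tree theorems; standard axioms only. Cell landau-siegel §D, ls-knife-typer-3 g11 (prover hand asked
by ls-knife-plan g0, INBOX 2026-08-27T11:44:59Z / 11:46:55Z).

«The programme SEARCHES and TYPES; no claim about Landau–Siegel zeros, Theorems 1–2 of
arXiv:2211.02515 or a repaired Margin232 until a kernel theorem says so.»

## References

* [Zhang2022LandauSiegel] Y. Zhang, Discrete mean estimates and the Landau–Siegel zero, arXiv:2211.02515v1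
  (2022): §2 p. 4 (Assumption (A), "for large D"), (2.16)–(2.17), §8 Lemma 8.1 / (8.5).
-/

namespace Summit.Parity.GeneralizedHardyLittlewood.Theorems

open Literature.NumberTheory.LFunctions.Zhang2022
open Literature.NumberTheory.LFunctions.Zhang2022.KnifeEdge
open Literature.NumberTheory.LFunctions.Zhang2022.Skeleton
open Summit.Parity.GeneralizedHardyLittlewood.Theses.ZDegreeToeplitzBand

/-! ## The half-class layer alone reaches the terminal -/

/-- K0 ∧ (short degree-1 tables) ∧ (dark) ∧ (Schur horn on short triples) ⇒ Theorem 1 — the C′ experiment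
decides the rung WITHOUT `LongPairsGradedTables` (𝒳₂). Either (A) fails eventually (tree horn
`theorem1_of_eventually_not_assumptionA`), or on the recurrent horn the short tables, darkness and the Schur
violation give `GradedClosesPsiOn ShortPairs c′` for all large `c′` (`gradedClosesPsiOn_short_of_schur`), which
with K0 gives Theorem 1 (`theorem1_of_gradedClosesPsiOn_pack_eventually`). Planner's proof, verbatim.
[cite: Zhang2022LandauSiegel, §2 (2.16)–(2.17)] -/
theorem theorem1_of_shortPairs (h0 : InClassSideTables) (hX' : ShortPairsCrossDegOne)
    (hY' : ShortPairsDualDegOne) (hd : ShortPairsTauTwoDark) (hs : ShortPairsSchurClose) :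
    Literature.NumberTheory.LFunctions.Zhang2022.Skeleton.Theorem1 := by
  by_cases hA : ForAllLarge (fun D _ χ => ¬ AssumptionA D χ)
  · exact theorem1_of_eventually_not_assumptionA hA
  · obtain ⟨c₁, h₁⟩ := hX'
    obtain ⟨c₁', h₁'⟩ := hY'
    obtain ⟨c₂, h₂⟩ := hd
    obtain ⟨c₃, h₃⟩ := hs hA
    refine theorem1_of_gradedClosesPsiOn_pack_eventually (𝒞 := ShortPairs) h0
      ⟨max (max c₁ c₁') (max c₂ c₃), fun c' hc' => ?_⟩
    have hc1 : c₁ ≤ c' := le_trans (le_trans (le_max_left _ _) (le_max_left _ _)) hc'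
    have hc1' : c₁' ≤ c' := le_trans (le_trans (le_max_right _ _) (le_max_left _ _)) hc'
    have hc2 : c₂ ≤ c' := le_trans (le_trans (le_max_left _ _) (le_max_right _ _)) hc'
    have hc3 : c₃ ≤ c' := le_trans (le_trans (le_max_right _ _) (le_max_right _ _)) hc'
    obtain ⟨X₁, hX⟩ := h₁ c' hc1
    obtain ⟨Y₁, hY⟩ := h₁' c' hc1'
    obtain ⟨f, f', g₁, g₁', g₂, g₂', hf, hg₁, hg₂, c01, c02, c12, hB0, hB2, hlt⟩ := h₃ c' hc3 X₁ Y₁ hX hY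
    exact gradedClosesPsiOn_short_of_schur hX hY (h₂ c' hc2) hf hg₁ hg₂ c01 c02 c12 hB0 hB2 hlt

/-! ## Weakness witnesses: parents ⇒ children (children are below their parents as typed) -/

/-- `PsiGradedTables ⇒ ShortPairsCrossDegOne`: restrict the full degree-1 cross table to short pairs.
[cite: Zhang2022LandauSiegel, §8 Lemma 8.1 / (8.5)] -/
theorem shortPairsCrossDegOne_of_parent (h : PsiGradedTables) : ShortPairsCrossDegOne := by
  obtain ⟨c₀, h⟩ := h
  exact ⟨c₀, fun c' hc' => by
    obtain ⟨X₁, Y₁, X₂, t1, -, -⟩ := h c' hc'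
    exact ⟨X₁, t1.on _⟩⟩

/-- `PsiGradedTables ⇒ ShortPairsDualDegOne`: restrict the full degree-1 dual table to short pairs.
[cite: Zhang2022LandauSiegel, §8 Lemma 8.1 / (8.5)] -/
theorem shortPairsDualDegOne_of_parent (h : PsiGradedTables) : ShortPairsDualDegOne := by
  obtain ⟨c₀, h⟩ := h
  exact ⟨c₀, fun c' hc' => by
    obtain ⟨X₁, Y₁, X₂, -, t21, -⟩ := h c' hc'
    exact ⟨Y₁, t21.on _⟩⟩

/-- `PsiGradedTables ⇒ LongPairsGradedTables`: restrict the two degree-1 tables to the non-short pairs, keep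
the degree-2 table whole. [cite: Zhang2022LandauSiegel, §8 Lemma 8.1 / (8.5)] -/
theorem longPairsGradedTables_of_parent (h : PsiGradedTables) : LongPairsGradedTables := by
  obtain ⟨c₀, h⟩ := h
  exact ⟨c₀, fun c' hc' => by
    obtain ⟨X₁, Y₁, X₂, t1, t21, t2⟩ := h c' hc'
    exact ⟨X₁, Y₁, X₂, t1.on _, t21.on _, t2⟩⟩

/-! ## Predicted-dark witnesses (typer-1 count v2 10:59:03Z): `X₁ := 0`, `Y₁ := 0` -/

/-- If the short degree-1 cross cell is dark (the table holds with the ZERO functional, eventually in `c′`),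
then `X₁ := 0` witnesses `ShortPairsCrossDegOne` (the predicted route).
[cite: Zhang2022LandauSiegel, §8 Lemma 8.1 / (8.5)] -/
theorem shortPairsCrossDegOne_of_dark
    (h : ∃ c₀ : ℝ, ∀ c' : ℝ, c₀ ≤ c' → CrossTablePsiOn c' ShortPairs 1 (fun _ _ _ _ => 0)) :
    ShortPairsCrossDegOne := by
  obtain ⟨c₀, h⟩ := h
  exact ⟨c₀, fun c' hc' => ⟨_, h c' hc'⟩⟩

/-- If the short degree-1 dual cell is dark, then `Y₁ := 0` witnesses `ShortPairsDualDegOne`.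
[cite: Zhang2022LandauSiegel, §8 Lemma 8.1 / (8.5)] -/
theorem shortPairsDualDegOne_of_dark
    (hY : ∃ c₀ : ℝ, ∀ c', c₀ ≤ c' → DualCrossTablePsiOn c' ShortPairs 1 (fun _ _ _ _ => 0)) :
    ShortPairsDualDegOne := by
  obtain ⟨c₀, h⟩ := hY
  exact ⟨c₀, fun c' hc' => ⟨_, h c' hc'⟩⟩

/-! ## Satisfiability witnesses on the horn where (A) fails eventually -/

/-- Darkness on the vacuous horn is free (like every (A)-guarded slot): if (A) fails for all large moduli,
`ShortPairsTauTwoDark` holds with threshold `0`. [cite: Zhang2022LandauSiegel, §2 p. 4] -/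
theorem shortPairsTauTwoDark_of_notAEventually (hA : ForAllLarge (fun D _ χ => ¬ AssumptionA D χ)) :
    ShortPairsTauTwoDark :=
  ⟨0, fun _ _ => tauTwoDarkShort_of_notAEventually hA⟩

/-- **SATISFIABILITY WITNESS for both split glues** (director 11:12:04Z (4)): all five children
`ShortPairsCrossDegOne`, `ShortPairsDualDegOne`, `LongPairsGradedTables`, `ShortPairsTauTwoDark`,
`ShortPairsSchurClose` hold simultaneously in the world where (A) fails eventually (every (A)-guarded slot is
vacuous there; the sign test's own hypothesis is contradicted) — so neither glue has contradictory
hypotheses. [cite: Zhang2022LandauSiegel, §2 p. 4] -/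
theorem children_of_notAEventually (hA : ForAllLarge (fun D _ χ => ¬ AssumptionA D χ)) :
    ShortPairsCrossDegOne ∧ ShortPairsDualDegOne ∧ LongPairsGradedTables ∧ ShortPairsTauTwoDark ∧
      ShortPairsSchurClose :=
  ⟨⟨0, fun _ _ => ⟨0, (crossTablePsi_of_notAEventually hA 1 0).on _⟩⟩,
   ⟨0, fun _ _ => ⟨0, (dualCrossTablePsi_of_notAEventually hA 1 0).on _⟩⟩,
   ⟨0, fun _ _ => ⟨0, 0, 0, (crossTablePsi_of_notAEventually hA 1 0).on _,
      (dualCrossTablePsi_of_notAEventually hA 1 0).on _, tauTwoTablePsi_of_notAEventually hA 0⟩⟩,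
   shortPairsTauTwoDark_of_notAEventually hA,
   fun h => absurd hA h⟩

/-! ## The typed kill path of the (a)-branch -/

/-- **KILL PATH of the (a)-branch, typed** (count v2 NET 10:59:03Z «short class PrintedTypeDark»): once BOTH
degree-1 short cells are dark (the tables hold with the zero functional, eventually in `c′`),
`ShortPairsSchurClose` is EQUIVALENT to «(A) fails eventually» — i.e. vacuous-true or summit-strength: on the
recurrent horn the sign test applied to `X₁ = Y₁ = 0` would demand `𝔅(g₁) < 0` for an in-class `g₁`,
impossible since `mainTermForm ≥ 0` on `H¹` pieces (`mainTermForm_nonneg_of_isH1`). The tenure lineage then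
retires the K2 decomposition as the typed null result of the half-class experiment.
[cite: Zhang2022LandauSiegel, §2 (2.16)–(2.17)] -/
theorem shortPairsSchurClose_iff_notAEventually_of_dark
    (hX : ∃ c₀ : ℝ, ∀ c', c₀ ≤ c' → CrossTablePsiOn c' ShortPairs 1 (fun _ _ _ _ => 0))
    (hY : ∃ c₀ : ℝ, ∀ c', c₀ ≤ c' → DualCrossTablePsiOn c' ShortPairs 1 (fun _ _ _ _ => 0)) :
    ShortPairsSchurClose ↔ ForAllLarge (fun D _ χ => ¬ AssumptionA D χ) := by
  constructor
  · intro h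
    by_contra hA
    obtain ⟨c₀, hc₀⟩ := h hA
    obtain ⟨cX, hcX⟩ := hX
    obtain ⟨cY, hcY⟩ := hY
    obtain ⟨f, f', g₁, g₁', g₂, g₂', -, hg₁, -, -, -, -, -, -, hlt⟩ :=
      hc₀ (max c₀ (max cX cY)) (le_max_left _ _) _ _
        (hcX _ ((le_max_left _ _).trans (le_max_right _ _)))
        (hcY _ ((le_max_right _ _).trans (le_max_right _ _)))
    have h1 := mainTermForm_nonneg_of_isH1 hg₁.kinked.isH1
    simp only [norm_zero, ne_eq, OfNat.ofNat_ne_zero, not_false_eq_true, zero_pow, zero_div,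
      add_zero] at hlt
    linarith
  · intro hA h
    exact absurd hA h

end Summit.Parity.GeneralizedHardyLittlewood.Theorems
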